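import Summits.RiemannHypothesis.RiemannHypothesis.Theorems.PfPersistenceEdgeLawCuspMass
import Summits.RiemannHypothesis.RiemannHypothesis.Theorems.PfPersistenceEdgeLawUpperHalf

/-!
# Edge law — (R3) from a cusp modulus: the interior dilation defect is `o(η)` (RH-free)

Part of the pub-rhpf THEORY-2 programme (mechanism / rigidity of the Weil window bottom; no RH
claims). Gen 5 reduced the log-Pohozaev identity `V = 2c₀·a·I` (and with it the two-sided edge
law `ε'(a) = −2c₀ I`) at differentiability windows to the single residue

  (R3) `D_a(t_η) = o(η)` for the interior dilation defect `t_η` (`HasInteriorRegularDefect`).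

This file discharges (R3) from ONE explicit, RH-free regularity hypothesis on the ground state,
the **cusp modulus** `HasCuspModulus a u C` (`ũ` is `C`-Lipschitz in the cusp coordinate of the
window — the logarithmic analogue of the Ros-Oton–Serra boundary gradient bound, satisfied by
the cusp model `τ/√log(1/(a−|x|))`):

* `windowDefectForm_weilInteriorDefect_le`: the explicit bound `D_a(t_η) ≤ cuspDefectBound a C η`
  (near arch from the Lipschitz-in-`Θ_η` increments, far arch + primes + pole from the mass with
  the split scale `δ = h/Λ(h)^{1/4}`);
* `tendsto_cuspDefectBound_div`: `cuspDefectBound a C η / η → 0`;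
* `hasInteriorRegularDefect_of_cuspModulus`: **cusp modulus ⇒ (R3)**;
* corollaries: the log-Pohozaev identity, the two-sided edge law, `WeilLogPohozaevAt a` and the
  `o(h)` corner energy under a cusp modulus, at differentiability windows of `ε`.

Sources: E. Bombieri, *Remarks on Weil's quadratic functional in the theory of prime numbers I*,
Rend. Mat. Acc. Lincei (9) 11 (2000) §4 Thm 3, Thm 5, §6; X. Ros-Oton, J. Serra, J. Math. Pures
Appl. 101 (2014) Thm 1.2 (model statement only).
-/

set_option linter.dupNamespace false

noncomputable section

open MeasureTheory Set Filter
open scoped Topology ENNReal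

namespace Summit.RiemannHypothesis.RiemannHypothesis.Theorems.PfPersistence

open Literature.NumberTheory.LFunctions
open Summit.RiemannHypothesis.RiemannHypothesis.Theorems.EvenWinsBeyondArch
open Summit.RiemannHypothesis.RiemannHypothesis.Theorems.WeilWindowFlowWindowLipschitz

variable {a : ℝ} {u : ℝ → ℂ}

/-! ## Constants -/

/-- The layer constant is nonnegative (`a > 0`). [folklore] -/
theorem layerConstant_nonneg (ha : 0 < a) : 0 ≤ layerConstant a := by
  unfold layerConstant
  have h1 := windowPoleConstant_nonneg a
  have h2 : 0 ≤ ∑ n ∈ weilPrimeIndex a, (ArithmeticFunction.vonMangoldt n : ℝ) / Real.sqrt n :=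
    Finset.sum_nonneg fun n _ ↦ div_nonneg ArithmeticFunction.vonMangoldt_nonneg (Real.sqrt_nonneg _)
  have h3 : 0 ≤ ∫ t in Ioi (min a 1), weilArchDensity t :=
    setIntegral_nonneg measurableSet_Ioi fun t ht ↦
      (weilArchDensity_pos ((lt_min ha one_pos).trans ht)).le
  have h4 : 0 ≤ min a 1 := le_min ha.le zero_le_one
  have h5 := abs_nonneg (Real.log (min a 1))
  have h6 := abs_nonneg (weilMarkovConstant a + weilGroundEnergy a)
  linarith

/-- The **cusp root** `q_a(η) = Λ_a(h(η))^{1/4}` (the split scale is `δ = h/q`). [folklore] -/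
def cuspRoot (a η : ℝ) : ℝ := Real.sqrt (Real.sqrt (cuspLog a (layerDepth a η)))

/-- `q_a(η) ≥ 1` for `0 < η ≤ 1`. [folklore] -/
theorem one_le_cuspRoot (ha : 0 < a) {η : ℝ} (hη : 0 < η) (hη1 : η ≤ 1) : 1 ≤ cuspRoot a η := by
  have hh0 := layerDepth_pos ha hη
  have hha : layerDepth a η ≤ a := by linarith [layerDepth_le_half ha.le hη.le hη1]
  have hΛ := two_lt_cuspLog hh0 hha
  unfold cuspRoot
  exact Real.one_le_sqrt.2 (Real.one_le_sqrt.2 (by linarith))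

/-- `q_a(η)⁴ = Λ_a(h(η))` for `0 < η ≤ 1`. [folklore] -/
theorem cuspRoot_pow_four (ha : 0 < a) {η : ℝ} (hη : 0 < η) (hη1 : η ≤ 1) :
    cuspRoot a η ^ 4 = cuspLog a (layerDepth a η) := by
  have hh0 := layerDepth_pos ha hη
  have hha : layerDepth a η ≤ a := by linarith [layerDepth_le_half ha.le hη.le hη1]
  have hΛ := (cuspLog_pos hh0 hha).le
  unfold cuspRoot
  rw [show (4 : ℕ) = 2 * 2 by norm_num, pow_mul, Real.sq_sqrt (Real.sqrt_nonneg _),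
    Real.sq_sqrt hΛ]

/-- `q_a(η)² = √Λ_a(h(η))`. [folklore] -/
theorem cuspRoot_sq (a η : ℝ) : cuspRoot a η ^ 2 = Real.sqrt (cuspLog a (layerDepth a η)) := by
  unfold cuspRoot
  exact Real.sq_sqrt (Real.sqrt_nonneg _)

/-- `q_a(η) → ∞` as `η → 0⁺`. [folklore] -/
theorem tendsto_cuspRoot_atTop (ha : 0 < a) : Tendsto (cuspRoot a) (𝓝[>] 0) atTop :=
  Real.tendsto_sqrt_atTop.comp (Real.tendsto_sqrt_atTop.comp
    ((tendsto_cuspLog_atTop a).comp (tendsto_layerDepth ha)))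

/-- The **explicit defect bound** under a cusp modulus `C`:
`E(η) = h C²(25 G(a) G(2h) + 72 G(2h)²) + (2 log(1/h) + 2K_a)·4a C² η² G(a)²
  + (2 + 2K_a)(4 C² G(a) + 64 C²)·h/q_a(η)`, `h = h(η)`, `G = cuspPrim a`. [folklore] -/
def cuspDefectBound (a C η : ℝ) : ℝ :=
  layerDepth a η * (C ^ 2 * (25 * cuspPrim a a * cuspPrim a (2 * layerDepth a η) +
      72 * cuspPrim a (2 * layerDepth a η) ^ 2)) +
    (2 * Real.log (1 / layerDepth a η) + 2 * layerConstant a) *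
      (4 * a * C ^ 2 * η ^ 2 * cuspPrim a a ^ 2) +
    (2 + 2 * layerConstant a) * (4 * C ^ 2 * cuspPrim a a + 64 * C ^ 2) *
      (layerDepth a η / cuspRoot a η)

/-! ## Finite energy of the interior defect -/

/-- The interior defect of a ground state has finite window energy (`0 < η ≤ 1`): it is in `L²`,
vanishes off the open window, and its arch energy converges. [folklore] -/
theorem weilInteriorDefect_finiteEnergy (hu : IsWeilGroundState a u) {η : ℝ} (hη : 0 < η)
    (hη1 : η ≤ 1) :
    MemLp (weilInteriorDefect a u η) 2 ∧ (∀ x, a ≤ |x| → weilInteriorDefect a u η x = 0) ∧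
      IntegrableOn (fun s ↦ weilArchDensity s * weilIncrement (weilInteriorDefect a u η) s)
        (Ioi 0) := by
  have ha := hu.pos
  have hσ2 := memLp_weilEdgeLayer hu (layerDepth a η)
  have hσs : ∀ x, a ≤ |x| → weilEdgeLayer a u (layerDepth a η) x = 0 := fun _ hx ↦
    weilEdgeLayer_eq_zero_of_le_abs _ hx
  have hσE := integrableOn_arch_weilEdgeLayer hu (layerDepth a η)
  have hw2 : MemLp (weilDilationDefect a u η) 2 :=
    memLp_weilDilationDefect hu.memLp (by linarith)
  have hws : ∀ x, a ≤ |x| → weilDilationDefect a u η x = 0 := fun _ hx ↦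
    weilDilationDefect_eq_zero ha.le hη.le hx
  have hwE := integrableOn_arch_weilDilationDefect hu hη.le hη1
  refine ⟨hw2.add hσ2, fun x hx ↦ ?_, dt_finiteEnergy_add hw2 hσ2 hwE hσE⟩
  rw [weilInteriorDefect, Pi.add_apply, hws x hx, hσs x hx, add_zero]

/-- `D_a(t_η) ≥ 0` for a ground state (`0 < η ≤ 1`). [folklore] -/
theorem windowDefectForm_weilInteriorDefect_nonneg (hu : IsWeilGroundState a u) {η : ℝ}
    (hη : 0 < η) (hη1 : η ≤ 1) : 0 ≤ windowDefectForm a (weilInteriorDefect a u η) := by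
  obtain ⟨h2, hs, hE⟩ := weilInteriorDefect_finiteEnergy hu hη hη1
  exact windowDefectForm_nonneg hu.pos h2 hs hE

/-! ## The explicit bound -/

/-- **The interior defect under a cusp modulus.** For a ground state with cusp modulus `C` and
`0 < η ≤ 1` with `h(η) ≤ 1/2`: `D_a(t_η) ≤ cuspDefectBound a C η`.
Near arch (`s ≤ h`): `∫ ρ D_s(t_η) ≤ h·C²(25 G(a)G(2h) + 72 G(2h)²)` from the increment bound;
the rest is `≤ (2 log(1/h) + 2K_a)‖t_η‖²`, and the mass bound with `δ = h/q`, `q⁴ = Λ(h)`,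
gives `‖t_η‖² ≤ 4aC²η²G(a)² + (4C²G(a) + 64C²) h/q⁵` while `log(1/h) ≤ Λ(h) = q⁴`.
[cite: Bombieri2000Weil, §4 Thm 5 (the dilation), §6] -/
theorem windowDefectForm_weilInteriorDefect_le (hu : IsWeilGroundState a u) {C : ℝ}
    (hC : HasCuspModulus a u C) {η : ℝ} (hη : 0 < η) (hη1 : η ≤ 1)
    (hhT : layerDepth a η ≤ 1 / 2) :
    windowDefectForm a (weilInteriorDefect a u η) ≤ cuspDefectBound a C η := by
  have ha := hu.pos
  have hC0 := hC.nonneg ha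
  have hK0 := layerConstant_nonneg ha
  obtain ⟨ht2, hts, htE⟩ := weilInteriorDefect_finiteEnergy hu hη hη1
  have hq1 : 1 ≤ cuspRoot a η := one_le_cuspRoot ha hη hη1
  have hq4 : cuspRoot a η ^ 4 = cuspLog a (layerDepth a η) := cuspRoot_pow_four ha hη hη1
  have hq2 : cuspRoot a η ^ 2 = Real.sqrt (cuspLog a (layerDepth a η)) := cuspRoot_sq a η
  set h := layerDepth a η with hh_def
  set t := weilInteriorDefect a u η with ht_def
  set q := cuspRoot a η with hq_def
  set K := layerConstant a with hK_def
  set G := cuspPrim a a with hG_def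
  set r := cuspPrim a (2 * h) with hr_def
  set Λ := cuspLog a h with hΛ_def
  have hh0 : 0 < h := layerDepth_pos ha hη
  have hha2 : h ≤ a / 2 := layerDepth_le_half ha.le hη.le hη1
  have hha : h ≤ a := by linarith
  have hq0 : 0 < q := by linarith
  have hq0' : q ≠ 0 := hq0.ne'
  have hG0 : 0 ≤ G := cuspPrim_nonneg _ _
  have hr0 : 0 ≤ r := cuspPrim_nonneg _ _
  -- step 1: near / far split of the window form
  have hmin : h ≤ min a 1 / 2 := by
    rw [le_div_iff₀ two_pos]
    exact le_min (by linarith) (by linarith)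
  have h1 := windowDefectForm_le_near_add ha ht2 hts rfl hh0 hmin htE
  -- step 2: the near arch from the increments
  set Φ := C ^ 2 * (25 * G * r + 72 * r ^ 2) with hΦ_def
  have hΦ0 : 0 ≤ Φ := by positivity
  have hD : ∀ s, 0 < s → s ≤ h → weilIncrement t s ≤ s * Φ := fun s hs hsh ↦
    weilIncrement_weilInteriorDefect_le hC ha hη hη1 hs hsh
  have h2 := setIntegral_arch_near_le hh0 (by linarith) hΦ0 hD
    (htE.mono_set Ioc_subset_Ioi_self)
  have h2' : ∫ s in Ioc 0 h, weilArchDensity s * weilIncrement t s ≤ h * Φ := by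
    refine h2.trans ?_
    calc h * (1 / 2 + h) * Φ = h * ((1 / 2 + h) * Φ) := by ring
      _ ≤ h * (1 * Φ) :=
          mul_le_mul_of_nonneg_left (mul_le_mul_of_nonneg_right (by linarith) hΦ0) hh0.le
      _ = h * Φ := by ring
  -- step 3: the mass with the split scale `δ = h/q`
  set δ := h / q with hδ_def
  have hδ0 : 0 < δ := div_pos hh0 hq0
  have hδh : δ ≤ h := div_le_self hh0.le hq1
  have h3 := integral_norm_sq_weilInteriorDefect_le hC ha hη hη1 hδ0 hδh
  have hS : h * cuspWeight a δ ≤ 1 / q ^ 5 := by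
    have hL : Λ ≤ cuspLog a δ := cuspLog_antitone a hδ0 hδh
    have hsq : Real.sqrt Λ ≤ Real.sqrt (cuspLog a δ) := Real.sqrt_le_sqrt hL
    have hΛ0 : 0 ≤ Λ := (cuspLog_pos hh0 hha).le
    have hprod : h * q ^ 5 ≤ δ * (cuspLog a δ * Real.sqrt (cuspLog a δ)) := by
      have e : h * q ^ 5 = δ * (q ^ 4 * q ^ 2) := by
        rw [hδ_def]; field_simp
      rw [e, hq4, hq2]
      exact mul_le_mul_of_nonneg_left (mul_le_mul hL hsq (Real.sqrt_nonneg _)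
        (hΛ0.trans hL)) hδ0.le
    have hpos : 0 < h * q ^ 5 := by positivity
    calc h * cuspWeight a δ = h * (1 / (δ * (cuspLog a δ * Real.sqrt (cuspLog a δ)))) := rfl
      _ ≤ h * (1 / (h * q ^ 5)) :=
          mul_le_mul_of_nonneg_left (one_div_le_one_div_of_le hpos hprod) hh0.le
      _ = 1 / q ^ 5 := by field_simp
  have hGh : cuspPrim a h ^ 2 = 4 / q ^ 4 := by rw [hq4]; exact cuspPrim_sq hh0 hha
  -- the mass in terms of `q`
  set P := 4 * C ^ 2 * G + 64 * C ^ 2 with hP_def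
  have hP0 : 0 ≤ P := by positivity
  set A₁ := 4 * a * C ^ 2 * η ^ 2 * G ^ 2 with hA₁_def
  have hm : ∫ x, ‖t x‖ ^ 2 ≤ A₁ + P * h / q ^ 5 := by
    clear h1 h2 h2' hD
    have e1 : 4 * C ^ 2 * (h * cuspWeight a δ) * (h * G) ≤ 4 * C ^ 2 * (1 / q ^ 5) * (h * G) :=
      mul_le_mul_of_nonneg_right (mul_le_mul_of_nonneg_left hS (by positivity)) (by positivity)
    have e2 : 16 * C ^ 2 * cuspPrim a h ^ 2 * δ = 64 * C ^ 2 * h / q ^ 5 := by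
      rw [hGh, hδ_def]; field_simp; ring
    have e3 : 4 * C ^ 2 * (1 / q ^ 5) * (h * G) + 64 * C ^ 2 * h / q ^ 5 = P * h / q ^ 5 := by
      rw [hP_def]; field_simp
    linarith only [h3, e1, e2, e3]
  -- step 4: `(2ℓ + 2K)·mass`
  have hℓ0 : 0 ≤ Real.log (1 / h) := Real.log_nonneg (by rw [le_div_iff₀ hh0]; linarith)
  have hℓΛ : Real.log (1 / h) ≤ q ^ 4 := by rw [hq4]; exact log_one_div_le_cuspLog a hh0
  have hw0 : 0 ≤ P * h / q ^ 5 := by positivity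
  have h4 : (2 * Real.log (1 / h) + 2 * K) * ∫ x, ‖t x‖ ^ 2 ≤
      (2 * Real.log (1 / h) + 2 * K) * A₁ + (2 * q ^ 4 + 2 * K) * (P * h / q ^ 5) := by
    have s1 := mul_le_mul_of_nonneg_left hm (by linarith : 0 ≤ 2 * Real.log (1 / h) + 2 * K)
    have s2 : (2 * Real.log (1 / h) + 2 * K) * (P * h / q ^ 5) ≤
        (2 * q ^ 4 + 2 * K) * (P * h / q ^ 5) :=
      mul_le_mul_of_nonneg_right (by linarith) hw0
    have e : (2 * Real.log (1 / h) + 2 * K) * (A₁ + P * h / q ^ 5) =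
        (2 * Real.log (1 / h) + 2 * K) * A₁ + (2 * Real.log (1 / h) + 2 * K) * (P * h / q ^ 5) := by
      ring
    linarith only [s1, s2, e]
  have h5 : (2 * q ^ 4 + 2 * K) * (P * h / q ^ 5) ≤ (2 + 2 * K) * P * (h / q) := by
    rw [show (2 * q ^ 4 + 2 * K) * (P * h / q ^ 5) = (2 + 2 * K / q ^ 4) * (P * (h / q)) by
      field_simp]
    have hK : 2 * K / q ^ 4 ≤ 2 * K := div_le_self (by positivity) (one_le_pow₀ hq1)
    have hw : 0 ≤ P * (h / q) := by positivity
    calc (2 + 2 * K / q ^ 4) * (P * (h / q)) ≤ (2 + 2 * K) * (P * (h / q)) :=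
          mul_le_mul_of_nonneg_right (by linarith only [hK]) hw
      _ = (2 + 2 * K) * P * (h / q) := by ring
  -- assemble
  have hfin : windowDefectForm a t ≤ h * Φ + (2 * Real.log (1 / h) + 2 * K) * A₁ +
      (2 + 2 * K) * P * (h / q) := by
    linarith only [h1, h2', h4, h5]
  unfold cuspDefectBound
  rw [← hh_def, ← hq_def, ← hK_def, ← hG_def, ← hr_def]
  exact hfin

/-! ## The bound is `o(η)` -/

/-- `η · log(1/h(η)) → 0` as `η → 0⁺`. [folklore] -/
theorem tendsto_mul_log_inv_layerDepth (ha : 0 < a) :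
    Tendsto (fun η ↦ η * Real.log (1 / layerDepth a η)) (𝓝[>] 0) (𝓝 0) := by
  have e : ∀ η ∈ Ioi (0 : ℝ), η * Real.log (1 + η) - η * Real.log a - η * Real.log η =
      η * Real.log (1 / layerDepth a η) := by
    intro η hη
    rw [mem_Ioi] at hη
    rw [layerDepth, one_div, Real.log_inv, Real.log_div (mul_pos ha hη).ne' (by linarith),
      Real.log_mul ha.ne' hη.ne']
    ring
  refine Tendsto.congr' (eventually_nhdsWithin_of_forall e) ?_
  have hid : Tendsto (fun η : ℝ ↦ η) (𝓝[>] 0) (𝓝 0) :=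
    tendsto_id.mono_left nhdsWithin_le_nhds
  have hA : Tendsto (fun η : ℝ ↦ η * Real.log (1 + η)) (𝓝[>] 0) (𝓝 0) := by
    have hc : ContinuousAt (fun η : ℝ ↦ Real.log (1 + η)) 0 :=
      (continuousAt_const.add continuousAt_id).log (by norm_num)
    have h1 : Tendsto (fun η : ℝ ↦ Real.log (1 + η)) (𝓝[>] 0) (𝓝 0) := by
      have := hc.tendsto
      simp only [add_zero, Real.log_one] at this
      exact this.mono_left nhdsWithin_le_nhds
    simpa using hid.mul h1
  have hB : Tendsto (fun η : ℝ ↦ η * Real.log a) (𝓝[>] 0) (𝓝 0) := by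
    simpa using hid.mul_const (Real.log a)
  have hC : Tendsto (fun η : ℝ ↦ η * Real.log η) (𝓝[>] 0) (𝓝 0) := by
    have := Real.continuous_mul_log.tendsto 0
    simp only [Real.log_zero, mul_zero] at this
    exact this.mono_left nhdsWithin_le_nhds
  simpa using (hA.sub hB).sub hC

/-- `G(2h(η)) → 0` as `η → 0⁺`. [folklore] -/
theorem tendsto_cuspPrim_two_mul_layerDepth (ha : 0 < a) :
    Tendsto (fun η ↦ cuspPrim a (2 * layerDepth a η)) (𝓝[>] 0) (𝓝 0) := by
  refine (tendsto_cuspPrim_zero a).comp ?_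
  have hh := tendsto_nhdsWithin_iff.1 (tendsto_layerDepth ha)
  refine tendsto_nhdsWithin_iff.2 ⟨?_, ?_⟩
  · simpa using hh.1.const_mul 2
  · filter_upwards [hh.2] with η hη
    rw [mem_Ioi] at hη ⊢
    linarith

/-- **The defect bound is `o(η)`**: `cuspDefectBound a C η / η → 0` as `η → 0⁺`
(`h/η → a`, `G(2h) → 0`, `η log(1/h) → 0`, `q → ∞`). [folklore] -/
theorem tendsto_cuspDefectBound_div (ha : 0 < a) (C : ℝ) :
    Tendsto (fun η ↦ cuspDefectBound a C η / η) (𝓝[>] 0) (𝓝 0) := by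
  have hhd := tendsto_layerDepth_div a
  have hr := tendsto_cuspPrim_two_mul_layerDepth ha
  have hℓ := tendsto_mul_log_inv_layerDepth ha
  have hq : Tendsto (fun η ↦ (cuspRoot a η)⁻¹) (𝓝[>] 0) (𝓝 0) :=
    tendsto_inv_atTop_zero.comp (tendsto_cuspRoot_atTop ha)
  have hid : Tendsto (fun η : ℝ ↦ η) (𝓝[>] 0) (𝓝 0) :=
    tendsto_id.mono_left nhdsWithin_le_nhds
  set G := cuspPrim a a
  set K := layerConstant a
  have T1 := hhd.mul (((hr.const_mul (25 * G)).add ((hr.mul hr).const_mul 72)).const_mul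
    (C ^ 2))
  have T2 := ((hℓ.const_mul 2).add (hid.const_mul (2 * K))).const_mul (4 * a * C ^ 2 * G ^ 2)
  have T3 := (hhd.mul hq).const_mul ((2 + 2 * K) * (4 * C ^ 2 * G + 64 * C ^ 2))
  have T := (T1.add T2).add T3
  simp only [mul_zero, add_zero] at T
  refine T.congr' ?_
  filter_upwards [self_mem_nhdsWithin] with η hη
  rw [mem_Ioi] at hη
  simp only [cuspDefectBound]
  field_simp
  ring

/-! ## (R3) and the log-Pohozaev identity from a cusp modulus -/

/-- **Cusp modulus ⇒ (R3).** A Weil ground state whose open-window truncation is Lipschitz in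
the cusp coordinate has an `o(η)` interior dilation defect: `D_a(t_η)/η → 0`.
[cite: Bombieri2000Weil, §4 Thm 5, §6] -/
theorem hasInteriorRegularDefect_of_cuspModulus (hu : IsWeilGroundState a u) {C : ℝ}
    (hC : HasCuspModulus a u C) : HasInteriorRegularDefect a u := by
  have ha := hu.pos
  have hpos : (0 : ℝ) < min 1 (1 / (2 * a)) := lt_min one_pos (by positivity)
  unfold HasInteriorRegularDefect
  refine tendsto_of_tendsto_of_tendsto_of_le_of_le' tendsto_const_nhds
    (tendsto_cuspDefectBound_div ha C) ?_ ?_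
  · filter_upwards [Ioc_mem_nhdsGT hpos] with η hη
    have hη1 : η ≤ 1 := hη.2.trans (min_le_left _ _)
    exact div_nonneg (windowDefectForm_weilInteriorDefect_nonneg hu hη.1 hη1) hη.1.le
  · filter_upwards [Ioc_mem_nhdsGT hpos] with η hη
    have hη1 : η ≤ 1 := hη.2.trans (min_le_left _ _)
    have hh : layerDepth a η ≤ 1 / 2 := by
      have h1 := layerDepth_le_mul ha.le hη.1.le
      have h2 : η ≤ 1 / (2 * a) := hη.2.trans (min_le_right _ _)
      have h3 : a * η ≤ a * (1 / (2 * a)) := mul_le_mul_of_nonneg_left h2 ha.le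
      rw [show a * (1 / (2 * a)) = 1 / 2 by field_simp] at h3
      linarith
    exact div_le_div_of_nonneg_right
      (windowDefectForm_weilInteriorDefect_le hu hC hη.1 hη1 hh) hη.1.le

/-- **The log-Pohozaev identity under a cusp modulus**: at a differentiability window `a` of
`ε`, a ground state with a cusp modulus, virial `V` and edge intensity `I` satisfies
`V = 2c₀·a·I`. [cite: Bombieri2000Weil, §4 Thm 3, §6] -/
theorem virial_eq_of_cuspModulus (hu : IsWeilGroundState a u) {C : ℝ}
    (hC : HasCuspModulus a u C) (hd : DifferentiableAt ℝ weilGroundEnergy a) {V I : ℝ}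
    (hV : HasDerivAt (weilDilationProfile a u) V 0) (hI : HasEdgeIntensity u a I) :
    V = 2 * edgeLawKernelConstant * a * I :=
  virial_eq_of_interiorRegular hu hd hV hI (hasInteriorRegularDefect_of_cuspModulus hu hC)

/-- **Two-sided edge law under a cusp modulus**: `ε'(a) = −2c₀·I(u)` at a differentiability
window. [cite: Bombieri2000Weil, §6] -/
theorem deriv_weilGroundEnergy_eq_of_cuspModulus (hu : IsWeilGroundState a u) {C : ℝ}
    (hC : HasCuspModulus a u C) (hd : DifferentiableAt ℝ weilGroundEnergy a) {V I : ℝ}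
    (hV : HasDerivAt (weilDilationProfile a u) V 0) (hI : HasEdgeIntensity u a I) :
    deriv weilGroundEnergy a = -(2 * edgeLawKernelConstant * I) :=
  deriv_weilGroundEnergy_eq_of_interiorRegular hu hd hV hI
    (hasInteriorRegularDefect_of_cuspModulus hu hC)

/-- **R6 from cusp moduli at differentiability windows**: if every ground state of the window
`a` admits a cusp modulus and `ε` is differentiable at `a`, then `WeilLogPohozaevAt a`.
[cite: Bombieri2000Weil, §4 Thm 3] -/
theorem weilLogPohozaevAt_of_cuspModulus
    (hmod : ∀ u : ℝ → ℂ, IsWeilGroundState a u → ∃ C, HasCuspModulus a u C)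
    (hd : DifferentiableAt ℝ weilGroundEnergy a) : WeilLogPohozaevAt a :=
  weilLogPohozaevAt_of_interiorRegular
    (fun u hu ↦ (hmod u hu).elim fun _ hC ↦ hasInteriorRegularDefect_of_cuspModulus hu hC) hd

/-- **(R2′) under a cusp modulus**: the corner energy is `o(h)` at differentiability windows.
[folklore] -/
theorem tendsto_cornerEnergy_div_zero_of_cuspModulus (hu : IsWeilGroundState a u) {C : ℝ}
    (hC : HasCuspModulus a u C) (hd : DifferentiableAt ℝ weilGroundEnergy a) {V I : ℝ}
    (hV : HasDerivAt (weilDilationProfile a u) V 0) (hI : HasEdgeIntensity u a I) :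
    Tendsto (fun h ↦ cornerEnergy a u h / h) (𝓝[>] 0) (𝓝 0) :=
  tendsto_cornerEnergy_div_zero_of_interiorRegular hu hd hV hI
    (hasInteriorRegularDefect_of_cuspModulus hu hC)

end Summit.RiemannHypothesis.RiemannHypothesis.Theorems.PfPersistence

end
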